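import Summits.Langlands.Langlands.Statement
import Summits.Langlands.Langlands.Theorems.IrreducibilityBySelfDualityWeakAbelianSummandHecke
import Literature.NumberTheory.GaloisRepresentations.WeakAbelianDirectSummandCyclotomicProofs
import Literature.NumberTheory.Automorphic.AlgebraicityParityGL
import HarnessLib

/-!
# Line `Sketch` for the crux `ReciprocityUpToIrreducibility` (item stmt-Langlands-14328),
# wave N12-R: weak automorphy of `E`-rational rank-one `ℓ`-adic representations

Support file (closes nothing; stub `stub_rankOne_weakAutomorphy_of_isRationalOver` of the registered
skeleton of line `Sketch`, continuation lead c9).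

Let `K` be any number field, `ℓ` a prime, `ι : ℚ̄_ℓ ≃+* ℂ`, `E ⊂ ℚ̄_ℓ` a number field
(`e : E →+* ℚ̄_ℓ`) and `ρ : Γ_K → GL₁(ℚ̄_ℓ)` an `E`-RATIONAL continuous character
(`FramedGaloisRep.IsRationalOver e`: at almost every place `ρ` is unramified with Frobenius
polynomial in `e(E[X])`, Böckle–Hui §2.1).  Then `ρ` is Satake–Frobenius compatible
(`SatakeFrobCompatibleAt`) at all but finitely many places with a cuspidal, L-algebraic automorphic
representation datum `π` of `GL₁(𝔸_K)` — the weak-automorphy conclusion B_w of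
Fontaine–Mazur–Langlands in rank one on the `E`-rational sector, unconditionally over every number
field:

* in rank one `ρ` is semisimple (`FramedGaloisRep.isSemisimple_toGaloisRep_of_rank_one`) and weakly
  divides itself (`FramedGaloisRep.weaklyDivides_self_of_eventually_isUnramifiedAt`: a cofinite
  set of places has Dirichlet density one), so Böckle–Hui 2025, Thm. 1.1 in the Hecke-character
  form of BH §3.2.1 — PROVED in the tree, `exists_heckeCharacter_of_weaklyDivides_holds` — gives an
  ALGEBRAIC Hecke character `θ` with `char ρ(Frob_v) = X - ι⁻¹(θ(ϖ_v))⁻¹` almost everywhere;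
* the Borel–Jacquet `GL(1)` datum `π_θ = ℂ·(θ ∘ det)/⊥` is cuspidal, regular algebraic, with Satake
  parameter `{θ(ϖ_v)}` almost everywhere
  (`WeakAbelianSummandHecke.exists_cuspidal_glOne_isRegularAlgebraic_of_isAlgebraic`);
* regular algebraic ⇒ C-algebraic (`AutomorphicRepData.IsRegularAlgebraic.isCAlgebraic`) ⇒
  L-algebraic on `GL_n` for `n = 1` odd (`AutomorphicRepData.IsCAlgebraic.isLAlgebraic_of_odd`:
  `(n-1)/2 ∈ ℤ`, Buzzard–Gee §3.1);
* `arithFrobPolyOfSatake ι q_v 1 {θ(ϖ_v)} = X - ι⁻¹(θ(ϖ_v))⁻¹` (`arithFrobPolyOfSatake_one`).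

References: G. Böckle, C.-Y. Hui, Math. Ann. 393 (2025), Thm. 1.1 and §3.2.1 [BockleHui2025];
A. Borel, H. Jacquet, Corvallis 1979, 4.6 [BorelJacquet1979]; K. Buzzard, T. Gee, LMS LNS 414
(2014), Def. 3.1.1 and §3.1 [BuzzardGeeLMS2014]; J.-M. Fontaine, B. Mazur, *Geometric Galois
representations* (1995), Conj. 1 [FontaineMazurGeometric1995].

No definitions; standard axioms only; no named fact.
-/

noncomputable section

set_option linter.dupNamespace false -- project-wide option (lakefile weak.linter.dupNamespace); `Summit.Langlands.Langlands` is the mandated namespace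

open scoped NumberField Classical Polynomial
open Filter IsDedekindDomain Polynomial
open Literature.NumberTheory.Automorphic Literature.NumberTheory.GaloisRepresentations
open Summit.Langlands

namespace Summit.Langlands.Langlands.Theorems.ReciprocityUpToIrreducibility

variable {K : Type} [Field K] [NumberField K] {ℓ : ℕ} [Fact ℓ.Prime]

/-- **Weak automorphy (direction (B), weak form) of an `E`-rational `ρ : Γ_K → GL₁(ℚ̄_ℓ)`.**  For
`ρ` `E`-rational (`FramedGaloisRep.IsRationalOver e`) and `ι : ℚ̄_ℓ ≃+* ℂ` there is a cuspidal,
L-algebraic automorphic representation datum `π` of `GL₁(𝔸_K)` which is Satake–Frobenius compatible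
with `ρ` at all but finitely many places: `ρ` is semisimple
(`FramedGaloisRep.isSemisimple_toGaloisRep_of_rank_one`) and weakly divides itself
(`FramedGaloisRep.weaklyDivides_self_of_eventually_isUnramifiedAt`), so Böckle–Hui's theorem
(`exists_heckeCharacter_of_weaklyDivides_holds`, proved in the tree) gives an algebraic Hecke
character `θ` with `char ρ(Frob_v) = X - ι⁻¹(θ(ϖ_v))⁻¹` a.e.; `π = π_θ = ℂ·(θ ∘ det)/⊥`
(`WeakAbelianSummandHecke.exists_cuspidal_glOne_isRegularAlgebraic_of_isAlgebraic`: cuspidal,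
regular algebraic, Satake parameter `{θ(ϖ_v)}` a.e.), L-algebraic since regular algebraic ⇒
C-algebraic ⇒ L-algebraic for `n = 1` odd (`IsRegularAlgebraic.isCAlgebraic`,
`IsCAlgebraic.isLAlgebraic_of_odd`), and
`arithFrobPolyOfSatake ι q_v 1 {θ(ϖ_v)} = X - ι⁻¹(θ(ϖ_v))⁻¹` (`arithFrobPolyOfSatake_one`).
[cite: BockleHui2025, Theorem 1.1 and §3.2.1] [cite: BorelJacquet1979, 4.6]
[cite: BuzzardGeeLMS2014, Def. 3.1.1 and §3.1]
[cite: FontaineMazurGeometric1995, Conj. 1 (n = 1)] -/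
theorem rankOne_weakAutomorphy_of_isRationalOver (hcpt : isCompact_glFiniteIntegralLevel 1 K)
    (ι : PadicAlgCl ℓ ≃+* ℂ) {E : Type} [Field E] [NumberField E] (e : E →+* PadicAlgCl ℓ)
    (ρ : FramedGaloisRep K (PadicAlgCl ℓ) 1) (hrat : ρ.IsRationalOver e) :
    ∃ π : CuspidalAutomorphicRepData 1 K hcpt, π.1.IsLAlgebraic ∧
      ∀ᶠ v : HeightOneSpectrum (𝓞 K) in cofinite, SatakeFrobCompatibleAt ι π.1 ρ v := by
  -- rank one: `ρ` is semisimple and weakly divides itself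
  have hss : ρ.toGaloisRep.IsSemisimple := FramedGaloisRep.isSemisimple_toGaloisRep_of_rank_one ρ
  have hwd : ρ.WeaklyDivides ρ :=
    FramedGaloisRep.weaklyDivides_self_of_eventually_isUnramifiedAt hrat.eventually_isUnramifiedAt
  -- Böckle–Hui, Thm. 1.1 (Hecke-character form): the algebraic Hecke character `θ` of `ρ`
  obtain ⟨θ, hθalg, hθ⟩ :=
    exists_heckeCharacter_of_weaklyDivides_holds K ℓ 1 E e ρ hss hrat ρ hwd ι
  -- the Borel–Jacquet datum `π_θ = ℂ·(θ ∘ det)/⊥`: cuspidal, regular algebraic, Satake `{θ(ϖ_v)}`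
  obtain ⟨τ, hτreg, hτsat⟩ :=
    WeakAbelianSummandHecke.exists_cuspidal_glOne_isRegularAlgebraic_of_isAlgebraic hcpt hθalg
  refine ⟨τ, hτreg.isCAlgebraic.isLAlgebraic_of_odd odd_one, ?_⟩
  filter_upwards [hθ, hτsat] with v hv hsat
  refine ⟨{θ.valueAtUniformizer v}, hsat, hv.2.1, ?_⟩
  rw [arithFrobPolyOfSatake_one, Multiset.map_singleton, Multiset.prod_singleton]
  exact hv.2.2

/-- **Registered stub `stub_rankOne_weakAutomorphy_of_isRationalOver` of line `Sketch` (crux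
stmt-Langlands-14328, wave N12-R), closed form of `rankOne_weakAutomorphy_of_isRationalOver`** (all
binders explicit, in the order `K, ℓ, hcpt, ι, E, e, ρ`): every `E`-rational
`ρ : Γ_K → GL₁(ℚ̄_ℓ)` is Satake–Frobenius compatible at almost all places with a cuspidal
L-algebraic `π` of `GL₁(𝔸_K)` (the Borel–Jacquet model of the algebraic Hecke character `θ` of `ρ`
given by Böckle–Hui, Thm. 1.1).
[cite: BockleHui2025, Theorem 1.1 and §3.2.1] [cite: BorelJacquet1979, 4.6]
[cite: FontaineMazurGeometric1995, Conj. 1 (n = 1)] -/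
theorem stub_rankOne_weakAutomorphy_of_isRationalOver :
    ∀ (K : Type) [Field K] [NumberField K] (ℓ : ℕ) [Fact ℓ.Prime]
      (hcpt : isCompact_glFiniteIntegralLevel 1 K) (ι : PadicAlgCl ℓ ≃+* ℂ)
      (E : Type) [Field E] [NumberField E] (e : E →+* PadicAlgCl ℓ)
      (ρ : FramedGaloisRep K (PadicAlgCl ℓ) 1), ρ.IsRationalOver e →
        ∃ π : CuspidalAutomorphicRepData 1 K hcpt, π.1.IsLAlgebraic ∧
          ∀ᶠ v : HeightOneSpectrum (𝓞 K) in cofinite, SatakeFrobCompatibleAt ι π.1 ρ v :=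
  fun _ _ _ _ _ hcpt ι _ _ _ e ρ hrat => rankOne_weakAutomorphy_of_isRationalOver hcpt ι e ρ hrat

end Summit.Langlands.Langlands.Theorems.ReciprocityUpToIrreducibility

end
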